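import Literature.ModelTheory.ExponentialFields.Wilkie1996Lemma93Valuation
import Mathlib.RingTheory.AlgebraicIndependent.TranscendenceBasis
import HarnessLib

/-!
# Wilkie 1996, §10 / den Besten, Theorem 7.1.22, Claim 2: valuation-independent elements are algebraically independent

Topic `Literature/ModelTheory/ExponentialFields`.  The valuation inequality `valdim ≤ dim` for a
smooth o-minimal theory (A. J. Wilkie, J. Amer. Math. Soc. 9 (1996), §10; M. den Besten, MSc
thesis, Utrecht 2016, Theorems 7.1.22–7.1.23) is the one ingredient of the proof of the
boundedness leaf `Wilkie1996_expPolynomialPoints_bounded` that this tree does not yet prove (see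
`Wilkie1996Lemma93Valuation.lean`, hypothesis `hVR`, and `Wilkie1996ValuationStep.lean`,
hypothesis `hval`).  Its proof (den Besten, proof of Theorem 7.1.22, pp. 86–87) has a purely
algebraic step,

> **Claim 2.** … we can find elements `a₁, …, a_{r+1} ∈ k* ∖ {0}` such that the vectors
> `ν_K(a₁), …, ν_K(a_{r+1})` are `ℚ`-linearly independent over `ν_K[k ∖ {0}]`.  We claim that
> the elements `a₁, …, a_{r+1}` are algebraically independent over `k`,

proved by the dominant-term argument (in a relation `Σ_η b_η a^η = 0` two distinct monomials
have the same value, whence `ν_K(b_η b_{η'}⁻¹) + Σᵢ (ηᵢ - η'ᵢ) ν_K(aᵢ) = 0`), and used in the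
form "*`k*` is the algebraic closure of `k(c₁, …, c_r)` in `K` … Combined with our second claim,
this gives `dim_ℚ(ν_K[k* ∖ {0}]) ≤ valdim(k) + r`*" — the rank half of the classical inequality
of Abhyankar for the natural valuation.  This file **proves** both, for an ordered field `K` that
is a model of `T_exp` (the setting of this topic) and any subfield `k₀` (an injective ring
homomorphism, in particular the embedding `f : k ↪ K` of a pair of models), in the language of
`Wilkie1996Lemma93Valuation.lean` (`RealExpModel.IsVUnit y`: `1/N ≤ |y| ≤ N` for some `N ∈ ℕ`,
i.e. `ν_K(y) = 0`) and without any valuation map: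

* `RealExpModel.exists_isVUnit_div_of_sum_eq_zero` — in a vanishing finite sum of nonzero
  elements two distinct summands are comparable (largest and second largest absolute value);
* `RealExpModel.exists_isVUnit_of_eval₂_eq_zero` — **Claim 2**, contrapositively: a nontrivial
  polynomial relation over `k₀` among nonzero `x₁, …, xₘ` yields `c ∈ k₀ ∖ {0}` and
  `e ∈ ℤᵐ ∖ {0}` with `c · Πⱼ xⱼ^{eⱼ}` a valuation unit; `…_of_forall_not_isVUnit`: the claim as
  printed (`AlgebraicIndependent`);
* `RealExpModel.exists_isVUnit_of_isAlgebraic_adjoin` — **the consequence**: in a `k₀`-subalgebra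
  `S ⊆ K` algebraic over `k₀[c₁, …, c_r]`, any `r + 1` nonzero elements admit such a relation
  (valuation rank of `S` over `k₀` is at most `r`; by Mathlib's transcendence degree,
  `trdeg_le_cardinalMk` and `AlgebraicIndependent.cardinalMk_le_trdeg`).

Nothing here is a named fact.

## References

* M. den Besten, *Wilkie's Theorem and the Uniform Real Schanuel Conjecture*, MSc thesis, Utrecht
  (2016): Theorem 7.1.22, Claim 2 and the paragraph following it (pp. 86–87). [DenBesten2016]
* A. J. Wilkie, *Model completeness results for expansions of the ordered field of real numbers by
  restricted Pfaffian functions and the exponential function*, J. Amer. Math. Soc. 9 (1996),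
  1051–1094: §10. [WilkieJAMS1996]
-/

noncomputable section

open FirstOrder FirstOrder.Language FirstOrder.Language.Structure
open MvPolynomial Cardinal

namespace Literature.ModelTheory.ExponentialFields

namespace RealExpModel

variable {k K : Language.Theory.ModelType.{0, 0, 0} realExpTheory}

/-! ### Dominant terms -/

/-- **Dominant terms of a vanishing sum are comparable.** If `Σ_{i ∈ T} tᵢ = 0` in the ordered
field `K` with all `tᵢ ≠ 0` and `T ≠ ∅`, then for some distinct `i₀, i₁ ∈ T` the quotient
`t_{i₀} / t_{i₁}` is a valuation unit (indeed `1 ≤ |t_{i₀} / t_{i₁}| ≤ |T| - 1`: `t_{i₀}` of largest,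
`t_{i₁}` of second largest absolute value). [folklore] -/
theorem exists_isVUnit_div_of_sum_eq_zero {ι : Type} [DecidableEq ι] (T : Finset ι) (t : ι → K)
    (hT : T.Nonempty) (ht : ∀ i ∈ T, t i ≠ 0) (hsum : ∑ i ∈ T, t i = 0) :
    ∃ i₀ ∈ T, ∃ i₁ ∈ T, i₀ ≠ i₁ ∧ IsVUnit (t i₀ / t i₁) := by
  obtain ⟨i₀, hi₀, hmax₀⟩ := T.exists_max_image (fun i => |t i|) hT
  have hT' : (T.erase i₀).Nonempty := by
    rw [Finset.nonempty_iff_ne_empty]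
    intro hempty
    have hTeq : T = {i₀} := by
      ext i
      rw [Finset.mem_singleton]
      refine ⟨fun hi => ?_, fun hi => hi ▸ hi₀⟩
      by_contra hne
      have hmem : i ∈ T.erase i₀ := Finset.mem_erase.2 ⟨hne, hi⟩
      rw [hempty] at hmem
      simp at hmem
    rw [hTeq, Finset.sum_singleton] at hsum
    exact ht i₀ hi₀ hsum
  obtain ⟨i₁, hi₁, hmax₁⟩ := (T.erase i₀).exists_max_image (fun i => |t i|) hT'
  obtain ⟨hne, hi₁T⟩ := Finset.mem_erase.1 hi₁
  refine ⟨i₀, hi₀, i₁, hi₁T, fun h => hne h.symm, ?_⟩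
  have h1 : |t i₁| ≤ |t i₀| := hmax₀ i₁ hi₁T
  have h2 : |t i₀| ≤ ((T.erase i₀).card : K) * |t i₁| := by
    have hs : t i₀ = -∑ i ∈ T.erase i₀, t i := by
      rw [← Finset.add_sum_erase T t hi₀] at hsum
      linear_combination hsum
    calc |t i₀| = |∑ i ∈ T.erase i₀, t i| := by rw [hs, abs_neg]
      _ ≤ ∑ i ∈ T.erase i₀, |t i| := Finset.abs_sum_le_sum_abs _ _
      _ ≤ ∑ i ∈ T.erase i₀, |t i₁| := Finset.sum_le_sum fun i hi => hmax₁ i hi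
      _ = ((T.erase i₀).card : K) * |t i₁| := by rw [Finset.sum_const, nsmul_eq_mul]
  have ht₁ : 0 < |t i₁| := abs_pos.2 (ht i₁ hi₁T)
  have hN : (1 : K) ≤ (T.erase i₀).card := by exact_mod_cast Finset.card_pos.2 hT'
  refine ⟨(T.erase i₀).card, ?_, ?_⟩
  · rw [abs_div]
    exact one_le_mul_of_one_le_of_one_le hN ((one_le_div ht₁).2 h1)
  · rw [abs_div, div_le_iff₀ ht₁]
    exact h2

/-! ### Claim 2: algebraic dependence forces valuation dependence -/

section Subfield

variable {k₀ : Type} [Field k₀]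

/-- **den Besten, Theorem 7.1.22, Claim 2 (contrapositive form): algebraically dependent
elements are valuation-dependent.** Let `g : k₀ → K` be a subfield (an injective ring
homomorphism into the ordered field `K ⊨ T_exp`) and `x₁, …, xₘ ∈ K` nonzero. If
`p(x₁, …, xₘ) = 0` for a nonzero polynomial `p` over `k₀`, then there are integers `e₁, …, eₘ`,
not all zero, and `c ∈ k₀`, `c ≠ 0`, such that `c · Πⱼ xⱼ^{eⱼ}` is a valuation unit — i.e. the
values `ν_K(x₁), …, ν_K(xₘ)` are `ℚ`-linearly dependent over `ν_K[k₀ ∖ {0}]` ("there do exist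
distinct `η, η' ∈ S` such that `ν_K(b_η a^η) = ν_K(b_{η'} a^{η'})` … rearranging gives
`ν_K(b_η b_{η'}⁻¹) + Σ (ηᵢ - η'ᵢ) ν_K(aᵢ) = 0`"). [cite: DenBesten2016, Theorem 7.1.22, Claim 2] -/
theorem exists_isVUnit_of_eval₂_eq_zero (g : k₀ →+* K) {m : ℕ}
    {x : Fin m → K} (hx : ∀ j, x j ≠ 0) {p : MvPolynomial (Fin m) k₀} (hp : p ≠ 0)
    (h0 : MvPolynomial.eval₂ g x p = 0) :
    ∃ e : Fin m → ℤ, e ≠ 0 ∧ ∃ c : k₀, c ≠ 0 ∧ IsVUnit (g c * ∏ j, x j ^ e j) := by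
  classical
  -- the monomial terms of the relation
  set t : (Fin m →₀ ℕ) → K := fun d => g (p.coeff d) * ∏ j, x j ^ d j with ht
  have hsum : ∑ d ∈ p.support, t d = 0 := by
    rw [← h0, MvPolynomial.eval₂_eq']
  have hne : p.support.Nonempty := MvPolynomial.support_nonempty.2 hp
  have htne : ∀ d ∈ p.support, t d ≠ 0 := fun d hd =>
    mul_ne_zero ((map_ne_zero g).2 (MvPolynomial.mem_support_iff.1 hd))
      (Finset.prod_ne_zero_iff.2 fun j _ => pow_ne_zero _ (hx j))
  obtain ⟨d₀, hd₀, d₁, hd₁, hne01, hu⟩ := exists_isVUnit_div_of_sum_eq_zero p.support t hne htne hsum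
  refine ⟨fun j => (d₀ j : ℤ) - d₁ j, ?_, p.coeff d₀ / p.coeff d₁,
    div_ne_zero (MvPolynomial.mem_support_iff.1 hd₀) (MvPolynomial.mem_support_iff.1 hd₁), ?_⟩
  · intro he
    apply hne01
    ext j
    have := congrFun he j
    simp only [Pi.zero_apply] at this
    omega
  · have e : g (p.coeff d₀ / p.coeff d₁) * ∏ j, x j ^ ((d₀ j : ℤ) - d₁ j) = t d₀ / t d₁ := by
      simp only [ht]
      rw [map_div₀, Finset.prod_congr rfl fun j _ => zpow_sub₀ (hx j) (d₀ j : ℤ) (d₁ j),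
        Finset.prod_div_distrib, div_mul_div_comm]
      simp only [zpow_natCast]
    rw [e]
    exact hu

variable [Algebra k₀ K]

/-- The same with the relation read through `MvPolynomial.aeval` for a `k₀`-algebra structure on
`K`. [cite: DenBesten2016, Theorem 7.1.22, Claim 2] -/
theorem exists_isVUnit_of_aeval_eq_zero {m : ℕ} {x : Fin m → K} (hx : ∀ j, x j ≠ 0)
    {p : MvPolynomial (Fin m) k₀} (hp : p ≠ 0) (h0 : MvPolynomial.aeval x p = 0) :
    ∃ e : Fin m → ℤ, e ≠ 0 ∧ ∃ c : k₀, c ≠ 0 ∧ IsVUnit (algebraMap k₀ K c * ∏ j, x j ^ e j) :=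
  exists_isVUnit_of_eval₂_eq_zero (algebraMap k₀ K) hx hp h0

/-- **Claim 2 as printed: valuation-independent elements are algebraically independent.** If no
`c · Πⱼ xⱼ^{eⱼ}` (`c ∈ k₀ ∖ {0}`, `e ∈ ℤᵐ ∖ {0}`) is a valuation unit, then the nonzero elements
`x₁, …, xₘ` are algebraically independent over `k₀`. [cite: DenBesten2016, Theorem 7.1.22, Claim 2] -/
theorem algebraicIndependent_of_forall_not_isVUnit {m : ℕ} {x : Fin m → K} (hx : ∀ j, x j ≠ 0)
    (hind : ∀ e : Fin m → ℤ, e ≠ 0 → ∀ c : k₀, c ≠ 0 →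
      ¬ IsVUnit (algebraMap k₀ K c * ∏ j, x j ^ e j)) :
    AlgebraicIndependent k₀ x := by
  rw [algebraicIndependent_iff]
  intro p hp
  by_contra hp0
  obtain ⟨e, he, c, hc, hu⟩ := exists_isVUnit_of_aeval_eq_zero hx hp0 hp
  exact hind e he c hc hu

/-- **The use of Claim 2 (den Besten, proof of Theorem 7.1.22: "Combined with our second claim,
this gives `dim_ℚ(ν_K[k* ∖ {0}]) ≤ valdim(k) + r`"): the valuation rank of an algebraic extension
of `k₀(c₁, …, c_r)` over `k₀` is at most `r`.** If `S ⊆ K` is a `k₀`-subalgebra algebraic over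
`k₀[c₁, …, c_r]` (`cᵢ ∈ S`), then any `r + 1` nonzero elements `y₀, …, y_r ∈ S` satisfy
`c · Πⱼ yⱼ^{eⱼ} ∈ Fin(K)ˣ` for some `c ∈ k₀ ∖ {0}` and some nonzero `e ∈ ℤ^{r+1}` — `r + 1`
algebraically independent elements would exceed the transcendence degree `≤ r` of `S` over `k₀`
(the rank half of Abhyankar's inequality for the natural valuation).
[cite: DenBesten2016, Theorem 7.1.22, Claim 2] -/
theorem exists_isVUnit_of_isAlgebraic_adjoin (S : Subalgebra k₀ K) {r : ℕ} (c : Fin r → S)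
    [Algebra.IsAlgebraic (Algebra.adjoin k₀ (Set.range c)) S] (y : Fin (r + 1) → S)
    (hy : ∀ j, (y j : K) ≠ 0) :
    ∃ e : Fin (r + 1) → ℤ, e ≠ 0 ∧ ∃ a : k₀, a ≠ 0 ∧
      IsVUnit (algebraMap k₀ K a * ∏ j, (y j : K) ^ e j) := by
  by_contra hcon
  push Not at hcon
  have hind : AlgebraicIndependent k₀ (fun j => (y j : K)) :=
    algebraicIndependent_of_forall_not_isVUnit hy fun e he a ha => hcon e he a ha
  have hindS : AlgebraicIndependent k₀ y :=
    AlgebraicIndependent.of_comp S.val (by exact hind)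
  have h1 : #(Fin (r + 1)) ≤ Algebra.trdeg k₀ S := hindS.cardinalMk_le_trdeg
  have h2 : Algebra.trdeg k₀ S ≤ #(Set.range c) :=
    Algebra.IsAlgebraic.trdeg_le_cardinalMk k₀ (Set.range c)
  have h3 : #(Set.range c) ≤ #(Fin r) := Cardinal.mk_range_le
  have h := h1.trans (h2.trans h3)
  rw [Cardinal.mk_fin, Cardinal.mk_fin] at h
  norm_cast at h
  omega

end Subfield

/-! ### The pair of models `f : k ↪ K` -/

/-- **Claim 2 for a pair of models `f : k ↪ K` of `T_exp`** (the setting of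
`Wilkie1996Lemma93Valuation.lean`): a nontrivial polynomial relation over `k` among nonzero
`x₁, …, xₘ ∈ K` gives `c ∈ k ∖ {0}` and `e ∈ ℤᵐ ∖ {0}` with `f(c) · Πⱼ xⱼ^{eⱼ}` a valuation unit.
[cite: DenBesten2016, Theorem 7.1.22, Claim 2] -/
theorem exists_isVUnit_of_eval₂_toRingHom_eq_zero (f : k ↪[Language.orderedExpRing] K) {m : ℕ}
    {x : Fin m → K} (hx : ∀ j, x j ≠ 0) {p : MvPolynomial (Fin m) k} (hp : p ≠ 0)
    (h0 : MvPolynomial.eval₂ (toRingHom f) x p = 0) :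
    ∃ e : Fin m → ℤ, e ≠ 0 ∧ ∃ c : k, c ≠ 0 ∧ IsVUnit (f c * ∏ j, x j ^ e j) :=
  exists_isVUnit_of_eval₂_eq_zero (toRingHom f) hx hp h0

end RealExpModel

end Literature.ModelTheory.ExponentialFields
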